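import Summits.QuantumFields.YangMills.Theorems.ComplexCouplingChannelComplexStrongCouplingAnchor
import Summits.QuantumFields.YangMills.Theorems.ComplexCouplingChannelFreeEnergyWindowChannelStubExpDecayOnCompacts
import Summits.QuantumFields.YangMills.Theorems.ComplexCouplingChannelFreeEnergyWindowChannelStubConnectedCompactJoin
import Summits.QuantumFields.YangMills.Theorems.FreeEnergyWindowChannel.Negative.WitnessRigidity
import Literature.MathematicalPhysics.QuantumFieldTheory.WilsonFinTorusPartitionComplex
import HarnessLib

/-!
# Window channels are exponentially thin (pointwise in `(G, r, β)`)

Stub `stub_expWindowAt` of line `Sketch` (layer 5: SELF-IMPROVEMENT of the window) for the crux `FreeEnergyWindowChannel`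
(`stmt-QuantumFields-18842`, route `ComplexCouplingChannel` of `QuantumFields/YangMills`), lead c3.

The crux asks, at a large real coupling `β` and for every anchor radius `ρ > 0`, for an open connected channel `D ∋ β`
through a real point `x`, `|x| < ρ`, one holomorphic `f` on `D` and a constant `M` with
`Z_P z ≠ 0 ∧ |log ‖Z_P z‖ + P⁴ Re f z| ≤ M` for all large `P`, `Z_P z = wilsonFinTorusPartitionC r.ρ z P P P P` the
complex-coupling Wilson partition function of the symmetric torus `P⁴`.

THIS FILE PROVES (sorry-free) that the constant `M` is idle: at a fixed admissible `(G, r)` and real `β`, window channels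
at `β` for every `ρ` give EXPONENTIAL window channels at `β` for every `ρ` — same shape with `M` replaced by `e^{-cP}`,
some `c > 0`.  Proof (`stub_expWindowAt`):
1. the PROVED strong-coupling anchor (`complexStrongCouplingAnchor_proof`: `|log ‖Z_P‖ + P⁴ Re f_A| ≤ C P⁴ e^{-cP}` on
   `‖z‖ < ρ₀`) and the window at `(β, min ρ (ρ₀/2))` overlap near the real point `x`; there the Archimedean step
   (`nonpos_of_forall_pow_four_mul_le`) pins `Re f = Re f_A`, so the window remainder is `≤ A e^{-(c/2)P}` on
   `D ∩ {dist · x < ρ₀/2}` (as in `TorusRemainderRigidity`, lead c2);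
2. the channel shrinks to an open connected `D' ∋ x, β` with `D' ⊆ K ⊆ D`, `K` compact (`stub_connectedCompactJoin`,
   p146690);
3. the exponential-rate engine `stub_expDecayOnCompacts` (p161803: real-part two-constants chain with exponent uniform on
   `K`) gives `|log ‖Z_P‖ + P⁴ Re f| ≤ e^{-c'P}` on `K ⊇ D'` for all large `P`.
So `FreeEnergyWindowChannel` is equivalent to its exponential form (the lead's skeleton composes this by name), and at
real `β` the symmetric-torus finite-size free energy is exponentially small — the torus input of the route's
`HarmonicMeasureEngine` (cf. `torusFreeEnergy_expSmall_of_anchor_of_window`, which proves the bound AT the point `β`; here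
it holds on a whole sub-channel).

References: R. Nevanlinna, *Eindeutige analytische Funktionen* (1936) §III.2 (two-constants theorem); route file
`Summits/QuantumFields/YangMills/Theses/ComplexCouplingChannel.lean`.
-/

set_option autoImplicit false

noncomputable section

open scoped Topology
open MeasureTheory Filter Set Metric Complex
open Literature.MathematicalPhysics.QuantumFieldTheory

namespace Summit.QuantumFields.YangMills.Theorems.FreeEnergyWindowChannel

/-- **Registered stub `stub_expWindowAt` of line `Sketch` (layer 5, lead c3): window channels are exponentially thin.**
At a fixed admissible `(G, r)` and real `β`: if for every `ρ > 0` there is an open connected `D ∋ β` through a real `x`,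
`|x| < ρ`, carrying a bounded window `Z_P z ≠ 0 ∧ |log ‖Z_P z‖ + P⁴ Re f z| ≤ M` (`P ≥ P₀`, one holomorphic `f`), then for
every `ρ > 0` there is such a channel carrying an EXPONENTIAL window `|log ‖Z_P z‖ + P⁴ Re f z| ≤ e^{-cP}` (`c > 0`).
Anchor pinning near `x` + `stub_connectedCompactJoin` + `stub_expDecayOnCompacts`. [folklore] -/
theorem stub_expWindowAt :
    ∀ (G : Type) [Group G] [TopologicalSpace G] [IsTopologicalGroup G] [CompactSpace G] [MeasurableSpace G] [BorelSpace G], Literature.MathematicalPhysics.QuantumFieldTheory.IsCompactSimpleLieGroup G → ∀ r : Literature.MathematicalPhysics.QuantumFieldTheory.LatticeRep G, ∀ β : ℝ,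
      (∀ ρ : ℝ, 0 < ρ →
        ∃ D : Set ℂ, IsOpen D ∧ IsConnected D ∧ (β : ℂ) ∈ D ∧ (∃ x : ℝ, |x| < ρ ∧ (x : ℂ) ∈ D) ∧
          ∃ f : ℂ → ℂ, DifferentiableOn ℂ f D ∧ ∃ M : ℝ, ∃ P₀ : ℕ, ∀ P : ℕ, P₀ ≤ P → ∀ z ∈ D,
            Literature.MathematicalPhysics.QuantumFieldTheory.wilsonFinTorusPartitionC r.ρ z P P P P ≠ 0 ∧
              |Real.log ‖Literature.MathematicalPhysics.QuantumFieldTheory.wilsonFinTorusPartitionC r.ρ z P P P P‖ +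
                (P : ℝ) ^ 4 * (f z).re| ≤ M) →
      ∀ ρ : ℝ, 0 < ρ →
        ∃ D : Set ℂ, IsOpen D ∧ IsConnected D ∧ (β : ℂ) ∈ D ∧ (∃ x : ℝ, |x| < ρ ∧ (x : ℂ) ∈ D) ∧
          ∃ f : ℂ → ℂ, DifferentiableOn ℂ f D ∧ ∃ c : ℝ, 0 < c ∧ ∃ P₀ : ℕ, ∀ P : ℕ, P₀ ≤ P → ∀ z ∈ D,
            Literature.MathematicalPhysics.QuantumFieldTheory.wilsonFinTorusPartitionC r.ρ z P P P P ≠ 0 ∧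
              |Real.log ‖Literature.MathematicalPhysics.QuantumFieldTheory.wilsonFinTorusPartitionC r.ρ z P P P P‖ +
                (P : ℝ) ^ 4 * (f z).re| ≤ Real.exp (-(c * P)) := by
  intro G _ _ _ _ _ _ hG r β h ρ hρ
  haveI : SecondCountableTopology G :=
    (r.continuous.isClosedEmbedding r.injective).isEmbedding.secondCountableTopology
  set Z : ℕ → ℂ → ℂ := fun P z => wilsonFinTorusPartitionC r.ρ z P P P P with hZ
  have hZd : ∀ P : ℕ, Differentiable ℂ (Z P) := fun P =>
    differentiable_wilsonFinTorusPartitionC r.ρ r.continuous P P P P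
  -- the proved anchor (torus clause)
  obtain ⟨ρ₀, hρ₀, c, hc, -, fA, -, C, hA⟩ :=
    Summit.QuantumFields.YangMills.Theorems.complexStrongCouplingAnchor_proof G hG r
  have hA' : ∀ P : ℕ, 1 ≤ P → ∀ z : ℂ, ‖z‖ < ρ₀ → Z P z ≠ 0 ∧
      |Real.log ‖Z P z‖ + (P : ℝ) ^ 4 * (fA z).re| ≤ C * (P : ℝ) ^ 4 * Real.exp (-(c * P)) :=
    fun P hP z hz => hA P hP z hz
  -- the window at `(β, min ρ (ρ₀ / 2))`
  have hρ' : 0 < min ρ (ρ₀ / 2) := lt_min hρ (half_pos hρ₀)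
  obtain ⟨D, hDo, hDc, hβD, ⟨x, hxρ, hxD⟩, f, hf, M, P₀, hwin⟩ := h (min ρ (ρ₀ / 2)) hρ'
  have hxρ1 : |x| < ρ := hxρ.trans_le (min_le_left _ _)
  have hxρ2 : |x| < ρ₀ / 2 := hxρ.trans_le (min_le_right _ _)
  have hwin' : ∀ P : ℕ, P₀ ≤ P → ∀ z ∈ D, Z P z ≠ 0 ∧
      |Real.log ‖Z P z‖ + (P : ℝ) ^ 4 * (f z).re| ≤ M := fun P hP z hz => hwin P hP z hz
  set P₁ : ℕ := max P₀ 1 with hP₁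
  -- a uniform constant for the anchor's remainder: `C P⁴ e^{-cP} ≤ A e^{-(c/2)P}`
  set C' : ℝ := max C 0 with hC'
  have hc2 : 0 < c / 2 := half_pos hc
  set A : ℝ := C' * (24 / (c / 2) ^ 4) + 1 with hAdef
  have hA0 : 0 < A := by rw [hAdef]; positivity
  have hanchor_le : ∀ P : ℕ, C * (P : ℝ) ^ 4 * Real.exp (-(c * P)) ≤ A * Real.exp (-(c / 2 * P)) := by
    intro P
    have hP0 : (0 : ℝ) ≤ P := Nat.cast_nonneg P
    have h24 := Summit.QuantumFields.YangMills.Theorems.ComplexCouplingChannel.pow_four_mul_exp_neg_le hc2 hP0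
    have hsplit : Real.exp (-(c * P)) = Real.exp (-(c / 2 * P)) * Real.exp (-(c / 2 * P)) := by
      rw [← Real.exp_add]; congr 1; ring
    have hX : 0 ≤ (P : ℝ) ^ 4 * Real.exp (-(c * P)) := by positivity
    calc C * (P : ℝ) ^ 4 * Real.exp (-(c * P)) = C * ((P : ℝ) ^ 4 * Real.exp (-(c * P))) := by ring
      _ ≤ C' * ((P : ℝ) ^ 4 * Real.exp (-(c * P))) := mul_le_mul_of_nonneg_right (le_max_left _ _) hX
      _ = C' * ((P : ℝ) ^ 4 * Real.exp (-(c / 2 * P))) * Real.exp (-(c / 2 * P)) := by rw [hsplit]; ring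
      _ ≤ C' * (24 / (c / 2) ^ 4) * Real.exp (-(c / 2 * P)) :=
          mul_le_mul_of_nonneg_right (mul_le_mul_of_nonneg_left h24 (le_max_right _ _)) (Real.exp_pos _).le
      _ ≤ A * Real.exp (-(c / 2 * P)) := by
          gcongr; rw [hAdef]; linarith
  have hεA : ∀ P : ℕ, A * Real.exp (-(c / 2 * P)) ≤ A := fun P => by
    have : Real.exp (-(c / 2 * P)) ≤ 1 := by
      rw [Real.exp_le_one_iff]; nlinarith [hc2, (Nat.cast_nonneg P : (0 : ℝ) ≤ P)]
    nlinarith [hA0]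
  -- Step 1: on the overlap `D ∩ {‖w‖ < ρ₀}` the two windows pin `Re f = Re f_A`
  have hre : ∀ w ∈ D, ‖w‖ < ρ₀ → (f w).re = (fA w).re := by
    intro w hwD hw
    have key : ∀ s : ℝ, (s = (f w).re - (fA w).re ∨ s = (fA w).re - (f w).re) → s ≤ 0 := by
      intro s hs
      refine Negative.nonpos_of_forall_pow_four_mul_le (P₀ := P₁) (K := M + A) fun P hP => ?_
      have hP₀ : P₀ ≤ P := (le_max_left _ _).trans hP
      have hP1 : 1 ≤ P := (le_max_right _ _).trans hP
      have h1 := (hwin' P hP₀ w hwD).2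
      have h2 := (((hA' P hP1 w hw).2).trans (hanchor_le P)).trans (hεA P)
      rw [abs_le] at h1 h2
      rcases hs with hs | hs <;> rw [hs] <;> nlinarith [h1.1, h1.2, h2.1, h2.2]
    have h1 := key _ (Or.inl rfl)
    have h2 := key _ (Or.inr rfl)
    linarith
  -- Step 2: pinning of the window remainder on `D ∩ ball x (ρ₀/2) ⊆ {‖w‖ < ρ₀}`
  have hpin : ∀ P : ℕ, P₁ ≤ P → ∀ w ∈ D, dist w (x : ℂ) < ρ₀ / 2 →
      |Real.log ‖Z P w‖ + (P : ℝ) ^ 4 * (f w).re| ≤ A * Real.exp (-(c / 2 * P)) := by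
    intro P hP w hwD hwx
    have hw : ‖w‖ < ρ₀ := by
      have hxn : ‖(x : ℂ)‖ < ρ₀ / 2 := by rw [norm_real, Real.norm_eq_abs]; exact hxρ2
      calc ‖w‖ = ‖(w - x) + x‖ := by ring_nf
        _ ≤ ‖w - (x : ℂ)‖ + ‖(x : ℂ)‖ := norm_add_le _ _
        _ < ρ₀ / 2 + ρ₀ / 2 := by rw [← dist_eq_norm]; exact add_lt_add hwx hxn
        _ = ρ₀ := by ring
    rw [hre w hwD hw]
    exact ((hA' P ((le_max_right _ _).trans hP) w hw).2).trans (hanchor_le P)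
  have hwin₁ : ∀ P : ℕ, P₁ ≤ P → ∀ z ∈ D, Z P z ≠ 0 ∧
      |Real.log ‖Z P z‖ + (P : ℝ) ^ 4 * (f z).re| ≤ M :=
    fun P hP z hz => hwin' P ((le_max_left _ _).trans hP) z hz
  -- Step 3: shrink the channel to a compactly contained sub-channel through `x` and `β`
  obtain ⟨D', K, hD'o, hD'c, hK, hxD', hβD', hD'K, hKD⟩ :=
    stub_connectedCompactJoin D hDo hDc (x : ℂ) hxD (β : ℂ) hβD
  -- Step 4: the exponential-rate engine on `K`
  obtain ⟨c', hc', P₂, hP₂⟩ := stub_expDecayOnCompacts Z D hDo hDc.isPreconnected hZd (x : ℂ) hxD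
    (ρ₀ / 2) (half_pos hρ₀) f hf M P₁ hwin₁ A (c / 2) hA0 hc2 hpin K hK hKD
  -- conclusion on the sub-channel `D'`
  refine ⟨D', hD'o, hD'c, hβD', ⟨x, hxρ1, hxD'⟩, f, hf.mono (hD'K.trans hKD), c', hc', max P₁ P₂,
    fun P hP z hz => ⟨?_, ?_⟩⟩
  · exact (hwin₁ P ((le_max_left _ _).trans hP) z (hKD (hD'K hz))).1
  · exact hP₂ P ((le_max_right _ _).trans hP) z (hD'K hz)

end Summit.QuantumFields.YangMills.Theorems.FreeEnergyWindowChannel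

end
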